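import Summits.CriticalPhenomena.PercolationContinuityZ3.Theorems.Transplant.FKConnectivityAllQTwoClusterRayleighNoSq
import HarnessLib

/-!
# Adjacent forest Rayleigh: the node's fibre `(M ∪ {e,f}, u₀)` IS the guarded fibre `(M, u₀)` — three fibre-count identities
# (bijections `ω₀ ↦ ω₀ ∪ {e,f}` and `ω₀ ↦ ω₀ ∪ {e}`), hence node ⇒ guarded form and guarded form ⇒ node on split fibres

Support file (`--supports stmt-CriticalPhenomena-4575`), FK sub-lane `prim-bschramm-fk-1` (gen 17) of the post-continuity programme;
builds on p205010 (kernel theorem, internal audit signed; external expert review pending).  No definitions, no named facts, no sorries;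
standard axioms.

For a fibre `(M, u₀)` and two pairs `e ≠ f` outside `M ∪ u₀`, write `M' = M ∪ {e, f}` and `G = {ω | e ∉ ω ∧ f ∉ ω}` (the guard of
p309484's `forestGuarded_of_gradedOn`).  For ARBITRARY events `P, Q`:
* **`fibreCount_insert_two_both`**: `#_{(M',u₀)}(P ∩ {e,f ∈ ω}, Q) = #_{(M,u₀)}(G ∩ {ω ∪ {e,f} ∈ P}, G ∩ Q)` (`ω₀ ↦ ω₀ ∪ {e,f}`);
* **`fibreCount_insert_two_minus`**: `#_{(M',u₀)}({e ∈ ω, ω∖{e} ∈ P}, {f ∈ ω, ω∖{f} ∈ Q}) = #_{(M,u₀)}(G ∩ P, G ∩ Q)` (`ω₀ ↦ ω₀ ∪ {e}`);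
* **`fibreCount_insert_two_one`**: `#_{(M',u₀)}(P ∩ {e ∈ ω}, Q ∩ {f ∈ ω}) = #_{(M,u₀)}(G ∩ {ω ∪ {e} ∈ P}, G ∩ {ω ∪ {f} ∈ Q})` (same map);
all through one reindexing lemma `fibreCount_eq_of_bij`.  With `P = Q = Fo` / `𝒳⁻` these are exactly the three terms of the
adjacent forest Rayleigh nodes, so: **`guarded_of_adjForestRayleighOn`** (node `AdjForestRayleighOn V` ⇒ the guarded inequality
`bad + sq ≤ good` on every fibre `(M, u₀)` with `e, f ∉ M ∪ u₀` — used by `…ForestSquareCex.lean`'s companion to REFUTE the node from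
the guarded counts), **`guarded_of_adjForestRayleighNoSqOn`** (square-free), and the converses on split fibres
`adjForest_fibre_of_guarded` / `adjForestNoSq_fibre_of_guarded` (one case of the lineage's step (c), memo
bschramm/FROM-fk-1-g16-FOREST-SLICE.md §3 item 4).
[cite: CibulkaHladkyLaCroixWagner2008, Thm. 1 (p. 2)] [cite: SempleWelsh2008, Conj. 1.1 (p. 2)] [cite: Linusson2011, Prop. 2.6]
-/

noncomputable section

namespace Summit.CriticalPhenomena.PercolationContinuityZ3.Theorems

namespace FK

open MeasureTheory Set Literature.Probability.LatticeModels Literature.Probability.Percolation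
open scoped Classical symmDiff

variable {V : Type*} [Fintype V]

/-! ### Reindexing a fibre count along a bijection -/

/-- **Reindexing**: two fibre counts agree when maps `φ`, `ψ` exchange the counted configurations. [cite: Linusson2011, Prop. 2.6] -/
theorem fibreCount_eq_of_bij {M u M' u' : BondConfig V} {A B A' B' : Set (BondConfig V)} (φ ψ : BondConfig V → BondConfig V)
    (h₁ : ∀ ω, ω \ M = u → ω ∈ A → ω ∆ M ∈ B → φ ω \ M' = u' ∧ φ ω ∈ A' ∧ (φ ω) ∆ M' ∈ B' ∧ ψ (φ ω) = ω)
    (h₂ : ∀ ω, ω \ M' = u' → ω ∈ A' → ω ∆ M' ∈ B' → ψ ω \ M = u ∧ ψ ω ∈ A ∧ (ψ ω) ∆ M ∈ B ∧ φ (ψ ω) = ω) :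
    fibreCount M u A B = fibreCount M' u' A' B' := by
  unfold fibreCount
  refine Finset.card_bij' (fun ω _ => φ ω) (fun ω _ => ψ ω) (fun ω hω => ?_) (fun ω hω => ?_) (fun ω hω => ?_) (fun ω hω => ?_)
  · rw [Finset.mem_filter] at hω ⊢
    obtain ⟨h1, h2, h3, -⟩ := h₁ ω hω.2.1 hω.2.2.1 hω.2.2.2
    exact ⟨Finset.mem_univ _, h1, h2, h3⟩
  · rw [Finset.mem_filter] at hω ⊢
    obtain ⟨h1, h2, h3, -⟩ := h₂ ω hω.2.1 hω.2.2.1 hω.2.2.2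
    exact ⟨Finset.mem_univ _, h1, h2, h3⟩
  · rw [Finset.mem_filter] at hω
    exact (h₁ ω hω.2.1 hω.2.2.1 hω.2.2.2).2.2.2
  · rw [Finset.mem_filter] at hω
    exact (h₂ ω hω.2.1 hω.2.2.1 hω.2.2.2).2.2.2

/-! ### Set identities for two pairs outside the fibre -/

section TwoPairs

variable {e f : Sym2 V} {M u₀ : BondConfig V}

omit [Fintype V] in
/-- `(ω₀ ∪ {e,f}) ∖ (M ∪ {e,f}) = ω₀ ∖ M` for `e, f ∉ ω₀`. [folklore] -/
theorem insert_two_sdiff_insert_two {ω₀ : BondConfig V} (he : e ∉ ω₀) (hf : f ∉ ω₀) :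
    insert f (insert e ω₀) \ insert f (insert e M) = ω₀ \ M := by
  ext x
  simp only [mem_sdiff, mem_insert_iff, not_or]
  constructor
  · rintro ⟨hx | hx | hx, hxf, hxe, hxM⟩
    · exact absurd hx hxf
    · exact absurd hx hxe
    · exact ⟨hx, hxM⟩
  · rintro ⟨hx, hxM⟩
    exact ⟨Or.inr (Or.inr hx), fun h => hf (h ▸ hx), fun h => he (h ▸ hx), hxM⟩

omit [Fintype V] in
/-- `(ω₀ ∪ {e,f}) ∆ (M ∪ {e,f}) = ω₀ ∆ M` for `e, f ∉ ω₀ ∪ M`. [folklore] -/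
theorem insert_two_symmDiff_insert_two {ω₀ : BondConfig V} (he : e ∉ ω₀) (hf : f ∉ ω₀) (heM : e ∉ M) (hfM : f ∉ M) :
    insert f (insert e ω₀) ∆ insert f (insert e M) = ω₀ ∆ M := by
  ext x
  simp only [Set.mem_symmDiff, mem_insert_iff, not_or]
  constructor
  · rintro (⟨hx | hx | hx, hxf, hxe, hxM⟩ | ⟨hx | hx | hx, hxf, hxe, hxω⟩)
    · exact absurd hx hxf
    · exact absurd hx hxe
    · exact Or.inl ⟨hx, hxM⟩
    · exact absurd hx hxf
    · exact absurd hx hxe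
    · exact Or.inr ⟨hx, hxω⟩
  · rintro (⟨hx, hxM⟩ | ⟨hx, hxω⟩)
    · exact Or.inl ⟨Or.inr (Or.inr hx), fun h => hf (h ▸ hx), fun h => he (h ▸ hx), hxM⟩
    · exact Or.inr ⟨Or.inr (Or.inr hx), fun h => hfM (h ▸ hx), fun h => heM (h ▸ hx), hxω⟩

omit [Fintype V] in
/-- `(ω₀ ∪ {e}) ∖ (M ∪ {e,f}) = ω₀ ∖ M` for `e, f ∉ ω₀`. [folklore] -/
theorem insert_sdiff_insert_two {ω₀ : BondConfig V} (he : e ∉ ω₀) (hf : f ∉ ω₀) :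
    insert e ω₀ \ insert f (insert e M) = ω₀ \ M := by
  ext x
  simp only [mem_sdiff, mem_insert_iff, not_or]
  constructor
  · rintro ⟨hx | hx, hxf, hxe, hxM⟩
    · exact absurd hx hxe
    · exact ⟨hx, hxM⟩
  · rintro ⟨hx, hxM⟩
    exact ⟨Or.inr hx, fun h => hf (h ▸ hx), fun h => he (h ▸ hx), hxM⟩

omit [Fintype V] in
/-- `(ω₀ ∪ {e}) ∆ (M ∪ {e,f}) = (ω₀ ∆ M) ∪ {f}` for `e ≠ f`, `e, f ∉ ω₀`, `e ∉ M`. [folklore] -/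
theorem insert_symmDiff_insert_two {ω₀ : BondConfig V} (hef : e ≠ f) (he : e ∉ ω₀) (hf : f ∉ ω₀) (heM : e ∉ M) :
    insert e ω₀ ∆ insert f (insert e M) = insert f (ω₀ ∆ M) := by
  ext x
  simp only [Set.mem_symmDiff, mem_insert_iff, not_or]
  constructor
  · rintro (⟨hx | hx, hxf, hxe, hxM⟩ | ⟨hx | hx | hx, hxe, hxω⟩)
    · exact absurd hx hxe
    · exact Or.inr (Or.inl ⟨hx, hxM⟩)
    · exact Or.inl hx
    · exact absurd hx hxe
    · exact Or.inr (Or.inr ⟨hx, hxω⟩)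
  · rintro (hx | ⟨hx, hxM⟩ | ⟨hx, hxω⟩)
    · exact Or.inr ⟨Or.inl hx, fun h => hef (h.symm.trans hx), fun h => hf (hx ▸ h)⟩
    · exact Or.inl ⟨Or.inr hx, fun h => hf (h ▸ hx), fun h => he (h ▸ hx), hxM⟩
    · exact Or.inr ⟨Or.inr (Or.inr hx), fun h => heM (h ▸ hx), hxω⟩

omit [Fintype V] in
/-- `e, f ∉ ω₀ ∆ M` when `e, f ∉ ω₀ ∪ M`. [folklore] -/
theorem notMem_symmDiff_of_notMem {ω₀ : BondConfig V} (he : e ∉ ω₀) (heM : e ∉ M) : e ∉ ω₀ ∆ M := by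
  rw [Set.mem_symmDiff]; rintro (⟨h, -⟩ | ⟨h, -⟩) <;> [exact he h; exact heM h]

omit [Fintype V] in
/-- `ω ∖ {e,f} ∪ {e,f} = ω` when `e, f ∈ ω`. [folklore] -/
theorem insert_two_sdiff_pair {ω : BondConfig V} (he : e ∈ ω) (hf : f ∈ ω) : insert f (insert e (ω \ {e, f})) = ω := by
  ext x
  simp only [mem_insert_iff, mem_sdiff, not_or]
  constructor
  · rintro (rfl | rfl | ⟨hx, -⟩) <;> [exact hf; exact he; exact hx]
  · intro hx
    by_cases hxf : x = f
    · exact Or.inl hxf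
    by_cases hxe : x = e
    · exact Or.inr (Or.inl hxe)
    · exact Or.inr (Or.inr ⟨hx, hxe, hxf⟩)

omit [Fintype V] in
/-- On the fibre `(M ∪ {e,f}, u₀)` with `f ∉ u₀`: if `f ∈ ω ∆ (M ∪ {e,f})` then `f ∉ ω`. [folklore] -/
theorem notMem_of_mem_symmDiff_insert {ω : BondConfig V} (h : f ∈ ω ∆ insert f (insert e M)) : f ∉ ω := by
  rw [Set.mem_symmDiff] at h
  rcases h with ⟨-, h⟩ | ⟨-, h⟩
  · exact absurd (mem_insert f _) h
  · exact h

/-! ### The three identities -/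

/-- **Both pairs inserted**: `#_{(M ∪ {e,f}, u₀)}(P ∩ {e, f ∈ ω}, Q) = #_{(M, u₀)}(G ∩ {ω ∪ {e,f} ∈ P}, G ∩ Q)`, `G = {e ∉ ω ∧ f ∉ ω}`.
[cite: Linusson2011, Prop. 2.6] [cite: CibulkaHladkyLaCroixWagner2008, Thm. 1 (p. 2)] -/
theorem fibreCount_insert_two_both (heM : e ∉ M) (hfM : f ∉ M) (P Q : Set (BondConfig V)) :
    fibreCount (insert f (insert e M)) u₀ (P ∩ {ω | e ∈ ω ∧ f ∈ ω}) Q =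
      fibreCount M u₀ ({ω | e ∉ ω ∧ f ∉ ω} ∩ {ω | insert f (insert e ω) ∈ P}) ({ω | e ∉ ω ∧ f ∉ ω} ∩ Q) := by
  symm
  refine fibreCount_eq_of_bij (fun ω => insert f (insert e ω)) (fun ω => ω \ {e, f}) (fun ω hω hA hB => ?_) (fun ω hω hA hB => ?_)
  · obtain ⟨⟨he, hf⟩, hP⟩ := hA
    obtain ⟨-, hQ⟩ := hB
    refine ⟨by rw [insert_two_sdiff_insert_two he hf, hω], ⟨hP, mem_insert_of_mem f (mem_insert e ω), mem_insert f _⟩,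
      by rw [insert_two_symmDiff_insert_two he hf heM hfM]; exact hQ, ?_⟩
    show insert f (insert e ω) \ {e, f} = ω
    ext x
    simp only [mem_sdiff, mem_insert_iff, mem_singleton_iff, not_or]
    constructor
    · rintro ⟨hx | hx | hx, hxe, hxf⟩
      · exact absurd hx hxf
      · exact absurd hx hxe
      · exact hx
    · intro hx; exact ⟨Or.inr (Or.inr hx), fun h => he (h ▸ hx), fun h => hf (h ▸ hx)⟩
  · obtain ⟨hP, he, hf⟩ := hA
    have he0 : e ∉ ω \ {e, f} := fun h => h.2 (Or.inl rfl)
    have hf0 : f ∉ ω \ {e, f} := fun h => h.2 (Or.inr rfl)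
    have hback : insert f (insert e (ω \ {e, f})) = ω := insert_two_sdiff_pair he hf
    refine ⟨?_, ⟨⟨he0, hf0⟩, by rw [mem_setOf_eq, hback]; exact hP⟩, ⟨⟨notMem_symmDiff_of_notMem he0 heM,
      notMem_symmDiff_of_notMem hf0 hfM⟩, ?_⟩, hback⟩
    · rw [← insert_two_sdiff_insert_two he0 hf0 (M := M), hback, hω]
    · show (ω \ {e, f}) ∆ M ∈ Q
      rw [← insert_two_symmDiff_insert_two he0 hf0 heM hfM, hback]; exact hB

/-- **One pair inserted, the other removed on each side**:
`#_{(M ∪ {e,f}, u₀)}({e ∈ ω, ω ∖ {e} ∈ P}, {f ∈ ω, ω ∖ {f} ∈ Q}) = #_{(M, u₀)}(G ∩ P, G ∩ Q)`.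
[cite: Linusson2011, Prop. 2.6] [cite: CibulkaHladkyLaCroixWagner2008, Thm. 1 (p. 2)] -/
theorem fibreCount_insert_two_minus (hef : e ≠ f) (heM : e ∉ M) (hfM : f ∉ M)
    (P Q : Set (BondConfig V)) :
    fibreCount (insert f (insert e M)) u₀ {ω | e ∈ ω ∧ ω \ {e} ∈ P} {ω | f ∈ ω ∧ ω \ {f} ∈ Q} =
      fibreCount M u₀ ({ω | e ∉ ω ∧ f ∉ ω} ∩ P) ({ω | e ∉ ω ∧ f ∉ ω} ∩ Q) := by
  symm
  refine fibreCount_eq_of_bij (fun ω => insert e ω) (fun ω => ω \ {e}) (fun ω hω hA hB => ?_) (fun ω hω hA hB => ?_)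
  · obtain ⟨⟨he, hf⟩, hP⟩ := hA
    obtain ⟨⟨heB, hfB⟩, hQ⟩ := hB
    have hdiff : insert e ω \ {e} = ω := insert_sdiff_self_of_notMem he
    refine ⟨by rw [insert_sdiff_insert_two he hf, hω], ⟨mem_insert _ _, by rw [hdiff]; exact hP⟩, ?_, hdiff⟩
    show f ∈ insert e ω ∆ insert f (insert e M) ∧ (insert e ω ∆ insert f (insert e M)) \ {f} ∈ Q
    rw [insert_symmDiff_insert_two hef he hf heM, insert_sdiff_self_of_notMem hfB]
    exact ⟨mem_insert _ _, hQ⟩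
  · obtain ⟨he, hP⟩ := hA
    obtain ⟨hfB, hQ⟩ := hB
    have hfω : f ∉ ω := notMem_of_mem_symmDiff_insert hfB
    have he0 : e ∉ ω \ {e} := fun h => h.2 rfl
    have hf0 : f ∉ ω \ {e} := fun h => hfω h.1
    have hback : insert e (ω \ {e}) = ω := by rw [insert_sdiff_singleton, insert_eq_of_mem (show e ∈ ω from he)]
    have hsd : insert f ((ω \ {e}) ∆ M) = ω ∆ insert f (insert e M) := by
      rw [← insert_symmDiff_insert_two hef he0 hf0 heM, hback]
    have hsd' : (ω \ {e}) ∆ M = (ω ∆ insert f (insert e M)) \ {f} := by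
      rw [← hsd, insert_sdiff_self_of_notMem (notMem_symmDiff_of_notMem hf0 hfM)]
    refine ⟨?_, ⟨⟨he0, hf0⟩, hP⟩, ?_, hback⟩
    · rw [← insert_sdiff_insert_two he0 hf0 (M := M), hback, hω]
    · refine ⟨⟨notMem_symmDiff_of_notMem he0 heM, notMem_symmDiff_of_notMem hf0 hfM⟩, ?_⟩
      show (ω \ {e}) ∆ M ∈ Q
      rw [hsd']; exact hQ

/-- **One pair inserted on each side**: `#_{(M ∪ {e,f}, u₀)}(P ∩ {e ∈ ω}, Q ∩ {f ∈ ω}) = #_{(M, u₀)}(G ∩ {ω ∪ {e} ∈ P}, G ∩ {ω ∪ {f} ∈ Q})`.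
[cite: Linusson2011, Prop. 2.6] [cite: CibulkaHladkyLaCroixWagner2008, Thm. 1 (p. 2)] -/
theorem fibreCount_insert_two_one (hef : e ≠ f) (heM : e ∉ M) (hfM : f ∉ M)
    (P Q : Set (BondConfig V)) :
    fibreCount (insert f (insert e M)) u₀ (P ∩ {ω | e ∈ ω}) (Q ∩ {ω | f ∈ ω}) =
      fibreCount M u₀ ({ω | e ∉ ω ∧ f ∉ ω} ∩ {ω | insert e ω ∈ P}) ({ω | e ∉ ω ∧ f ∉ ω} ∩ {ω | insert f ω ∈ Q}) := by
  symm
  refine fibreCount_eq_of_bij (fun ω => insert e ω) (fun ω => ω \ {e}) (fun ω hω hA hB => ?_) (fun ω hω hA hB => ?_)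
  · obtain ⟨⟨he, hf⟩, hP⟩ := hA
    obtain ⟨⟨heB, hfB⟩, hQ⟩ := hB
    have hdiff : insert e ω \ {e} = ω := insert_sdiff_self_of_notMem he
    refine ⟨by rw [insert_sdiff_insert_two he hf, hω], ⟨hP, mem_insert _ _⟩, ?_, hdiff⟩
    show insert e ω ∆ insert f (insert e M) ∈ Q ∧ f ∈ insert e ω ∆ insert f (insert e M)
    rw [insert_symmDiff_insert_two hef he hf heM]
    exact ⟨hQ, mem_insert _ _⟩
  · obtain ⟨hP, he⟩ := hA
    obtain ⟨hQ, hfB⟩ := hB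
    have hfω : f ∉ ω := notMem_of_mem_symmDiff_insert hfB
    have he0 : e ∉ ω \ {e} := fun h => h.2 rfl
    have hf0 : f ∉ ω \ {e} := fun h => hfω h.1
    have hback : insert e (ω \ {e}) = ω := by rw [insert_sdiff_singleton, insert_eq_of_mem (show e ∈ ω from he)]
    have hsd : insert f ((ω \ {e}) ∆ M) = ω ∆ insert f (insert e M) := by
      rw [← insert_symmDiff_insert_two hef he0 hf0 heM, hback]
    refine ⟨?_, ⟨⟨he0, hf0⟩, by rw [mem_setOf_eq, hback]; exact hP⟩, ?_, hback⟩
    · rw [← insert_sdiff_insert_two he0 hf0 (M := M), hback, hω]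
    · refine ⟨⟨notMem_symmDiff_of_notMem he0 heM, notMem_symmDiff_of_notMem hf0 hfM⟩, ?_⟩
      show insert f ((ω \ {e}) ∆ M) ∈ Q
      rw [hsd]; exact hQ

end TwoPairs

/-! ### Node ⟺ guarded form on fibres split off the two pinned pairs -/

/-- **Node ⇒ guarded form**: `AdjForestRayleighOn V` gives `bad + sq ≤ good` in the guarded fibre form of `forestGuarded_of_gradedOn`
on every fibre `(M, u₀)` with `e = ov`, `f = oy` outside `M ∪ u₀`. [cite: CibulkaHladkyLaCroixWagner2008, Thm. 1 (p. 2)]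
[cite: SempleWelsh2008, Conj. 1.1 (p. 2)] -/
theorem guarded_of_adjForestRayleighOn (h : AdjForestRayleighOn V) {M u₀ : BondConfig V} (hd : Disjoint u₀ M) {o v y : V}
    (hvy : v ≠ y) (heM : s(o, v) ∉ M) (hfM : s(o, y) ∉ M) (heu : s(o, v) ∉ u₀) (hfu : s(o, y) ∉ u₀) :
    fibreCount M u₀ ({ω | s(o, v) ∉ ω ∧ s(o, y) ∉ ω} ∩ {ω | insert s(o, y) (insert s(o, v) ω) ∈ forestEv V})
        ({ω | s(o, v) ∉ ω ∧ s(o, y) ∉ ω} ∩ forestEv V) +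
      fibreCount M u₀ ({ω | s(o, v) ∉ ω ∧ s(o, y) ∉ ω} ∩ xMinusEv o v y) ({ω | s(o, v) ∉ ω ∧ s(o, y) ∉ ω} ∩ xMinusEv o v y) ≤
      fibreCount M u₀ ({ω | s(o, v) ∉ ω ∧ s(o, y) ∉ ω} ∩ {ω | insert s(o, v) ω ∈ forestEv V})
        ({ω | s(o, v) ∉ ω ∧ s(o, y) ∉ ω} ∩ {ω | insert s(o, y) ω ∈ forestEv V}) := by
  have hef : s(o, v) ≠ s(o, y) := fun h' => hvy (Sym2.congr_right.1 h')
  have hd' : Disjoint u₀ (insert s(o, y) (insert s(o, v) M)) := by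
    rw [Set.disjoint_insert_right, Set.disjoint_insert_right]; exact ⟨hfu, heu, hd⟩
  have key := h _ u₀ hd' o v y hvy
  rw [fibreCount_insert_two_both heM hfM, fibreCount_insert_two_minus hef heM hfM,
    fibreCount_insert_two_one hef heM hfM] at key
  exact key

/-- **Guarded form ⇒ node on the split fibre** `(M ∪ {e,f}, u₀)` (one case of the lineage's step (c)).
[cite: CibulkaHladkyLaCroixWagner2008, Thm. 1 (p. 2)] -/
theorem adjForest_fibre_of_guarded {M u₀ : BondConfig V} {o v y : V} (hvy : v ≠ y) (heM : s(o, v) ∉ M) (hfM : s(o, y) ∉ M)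
    (hg : fibreCount M u₀ ({ω | s(o, v) ∉ ω ∧ s(o, y) ∉ ω} ∩ {ω | insert s(o, y) (insert s(o, v) ω) ∈ forestEv V})
        ({ω | s(o, v) ∉ ω ∧ s(o, y) ∉ ω} ∩ forestEv V) +
      fibreCount M u₀ ({ω | s(o, v) ∉ ω ∧ s(o, y) ∉ ω} ∩ xMinusEv o v y) ({ω | s(o, v) ∉ ω ∧ s(o, y) ∉ ω} ∩ xMinusEv o v y) ≤
      fibreCount M u₀ ({ω | s(o, v) ∉ ω ∧ s(o, y) ∉ ω} ∩ {ω | insert s(o, v) ω ∈ forestEv V})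
        ({ω | s(o, v) ∉ ω ∧ s(o, y) ∉ ω} ∩ {ω | insert s(o, y) ω ∈ forestEv V})) :
    fibreCount (insert s(o, y) (insert s(o, v) M)) u₀ (forestEv V ∩ {ω | s(o, v) ∈ ω ∧ s(o, y) ∈ ω}) (forestEv V) +
      fibreCount (insert s(o, y) (insert s(o, v) M)) u₀ {ω | s(o, v) ∈ ω ∧ ω \ {s(o, v)} ∈ xMinusEv o v y}
        {ω | s(o, y) ∈ ω ∧ ω \ {s(o, y)} ∈ xMinusEv o v y} ≤
      fibreCount (insert s(o, y) (insert s(o, v) M)) u₀ (forestEv V ∩ {ω | s(o, v) ∈ ω}) (forestEv V ∩ {ω | s(o, y) ∈ ω}) := by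
  have hef : s(o, v) ≠ s(o, y) := fun h' => hvy (Sym2.congr_right.1 h')
  rw [fibreCount_insert_two_both heM hfM, fibreCount_insert_two_minus hef heM hfM, fibreCount_insert_two_one hef heM hfM]
  exact hg

/-- **Square-free node ⇒ guarded square-free form** on fibres split off `e, f`. [cite: SempleWelsh2008, Conj. 1.1 (p. 2)] -/
theorem guarded_of_adjForestRayleighNoSqOn (h : AdjForestRayleighNoSqOn V) {M u₀ : BondConfig V} (hd : Disjoint u₀ M) {o v y : V}
    (hvy : v ≠ y) (heM : s(o, v) ∉ M) (hfM : s(o, y) ∉ M) (heu : s(o, v) ∉ u₀) (hfu : s(o, y) ∉ u₀) :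
    fibreCount M u₀ ({ω | s(o, v) ∉ ω ∧ s(o, y) ∉ ω} ∩ {ω | insert s(o, y) (insert s(o, v) ω) ∈ forestEv V})
        ({ω | s(o, v) ∉ ω ∧ s(o, y) ∉ ω} ∩ forestEv V) ≤
      fibreCount M u₀ ({ω | s(o, v) ∉ ω ∧ s(o, y) ∉ ω} ∩ {ω | insert s(o, v) ω ∈ forestEv V})
        ({ω | s(o, v) ∉ ω ∧ s(o, y) ∉ ω} ∩ {ω | insert s(o, y) ω ∈ forestEv V}) := by
  have hef : s(o, v) ≠ s(o, y) := fun h' => hvy (Sym2.congr_right.1 h')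
  have hd' : Disjoint u₀ (insert s(o, y) (insert s(o, v) M)) := by
    rw [Set.disjoint_insert_right, Set.disjoint_insert_right]; exact ⟨hfu, heu, hd⟩
  have key := h _ u₀ hd' o v y hvy
  rw [fibreCount_insert_two_both heM hfM, fibreCount_insert_two_one hef heM hfM] at key
  exact key

/-- **Guarded square-free form ⇒ square-free node on the split fibre.** [cite: SempleWelsh2008, Conj. 1.1 (p. 2)] -/
theorem adjForestNoSq_fibre_of_guarded {M u₀ : BondConfig V} {o v y : V} (hvy : v ≠ y) (heM : s(o, v) ∉ M) (hfM : s(o, y) ∉ M)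
    (hg : fibreCount M u₀ ({ω | s(o, v) ∉ ω ∧ s(o, y) ∉ ω} ∩ {ω | insert s(o, y) (insert s(o, v) ω) ∈ forestEv V})
        ({ω | s(o, v) ∉ ω ∧ s(o, y) ∉ ω} ∩ forestEv V) ≤
      fibreCount M u₀ ({ω | s(o, v) ∉ ω ∧ s(o, y) ∉ ω} ∩ {ω | insert s(o, v) ω ∈ forestEv V})
        ({ω | s(o, v) ∉ ω ∧ s(o, y) ∉ ω} ∩ {ω | insert s(o, y) ω ∈ forestEv V})) :
    fibreCount (insert s(o, y) (insert s(o, v) M)) u₀ (forestEv V ∩ {ω | s(o, v) ∈ ω ∧ s(o, y) ∈ ω}) (forestEv V) ≤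
      fibreCount (insert s(o, y) (insert s(o, v) M)) u₀ (forestEv V ∩ {ω | s(o, v) ∈ ω}) (forestEv V ∩ {ω | s(o, y) ∈ ω}) := by
  have hef : s(o, v) ≠ s(o, y) := fun h' => hvy (Sym2.congr_right.1 h')
  rw [fibreCount_insert_two_both heM hfM, fibreCount_insert_two_one hef heM hfM]
  exact hg


end FK

end Summit.CriticalPhenomena.PercolationContinuityZ3.Theorems

end
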